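import Mathlib

/-!
# Coincidences of a function with its translates (crux `LaminatedThreshold`, idea `horizon-shadowed-bag`)

GR-free engines for piece (s3c) `NoFlatChartInLateBag` of the crux idea
`Cruxes/LaminatedThreshold/Ideas/horizon-shadowed-bag.md` (round 2; passed triage,
`TRIAGE-r2-2.md`). In the exact late Milne bag `cone/Γ` (the interior of the future light cone of
Minkowski space modulo a cocompact Kleinian group `Γ` acting on the hyperboloids `T = const ≅ H³`)
a spacelike slab whose lift to the universal cover is achronal is a graph `T = exp (u x)` over a
region `Ω ⊆ H³`, and the slab is injectively projected to the quotient iff no deck transformation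
`γ ≠ 1` has a *coincidence point* `x ∈ Ω ∩ γ⁻¹Ω` with `u (γ • x) = u x` (`TRIAGE-r2-2.md`,
§horizon-shadowed-bag, evidence (3)). This file isolates the point-set part of that discussion as
statements about a group `G` acting by homeomorphisms on a topological space `H` and a real
function `u` continuous on `Ω ⊆ H`:

* `pos_or_neg_of_forall_ne_zero` — sign constancy of a zero-free continuous function on a
  preconnected set;
* `positiveCone_of_translates_ne` — if every displacement `u ∘ (γ • ·) - u`, `γ ≠ 1`, is zero-free
  on the (preconnected) overlap `Ω ∩ γ⁻¹Ω` and the overlaps have common "triple points", the signs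
  assemble into a positive cone `P ⊆ G` (`1 ∉ P`, `P * P ⊆ P`, `G = P ∪ P⁻¹ ∪ {1}`);
* `leftInvariantOrder_of_positiveCone` — a positive cone is the same as a left-invariant strict
  total order, so `G` is left-orderable (the triage's obstruction: for a closed hyperbolic `Y`
  with non-left-orderable `π₁ Y`, no such `u` exists);
* `exists_translate_eq_of_not_leftOrderable` — the contrapositive, entire version (`Ω = H`);
* `exists_translate_eq_of_isMaxOn` / `exists_translate_eq_of_isMinOn` — an orderability-free
  ending: if `u` attains its maximum (or minimum) on `Ω` at a point whose `γ`- and `γ⁻¹`-translates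
  stay in `Ω`, then `γ` HAS a coincidence point, for every single `γ` (so an achronal lifted slab
  whose height `log T` attains an extremum meets each of its deck translates);
* `exists_shift_eq_of_forall_le` / `exists_shift_eq_of_tendsto_atTop` — the one-dimensional case
  `G = ℤ ↷ ℝ` behind the card's 1+1 toy (Cheapest falsifier (2): a graph `ln T = h χ̃` with
  `h → ∞` at both ends meets its `ℓ`-shift, so the slice self-intersects in the strip
  `χ ∼ χ + ℓ`).

Everything is elementary (intermediate value theorem on preconnected sets); the positive-cone /
left-order dictionary is standard [cite: CalegariRolfsen2014, §2]. No Lorentzian geometry is used: the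
reduction of (s3c) to these statements (achronality of the lift, the shape of `Ω`, connectedness
of the overlaps) is the business of the line that registers `NoFlatChartInLateBag`.
-/

set_option linter.dupNamespace false

namespace Summit.FinalStateConjecture.FinalStateConjecture.Theorems.LaminatedThreshold.HorizonShadowedBag

open Set Filter Topology

section SignConstancy

variable {H : Type} [TopologicalSpace H]

/-- On a preconnected set a continuous zero-free real function is everywhere positive or
everywhere negative. [folklore] -/
theorem pos_or_neg_of_forall_ne_zero {s : Set H} (hs : IsPreconnected s) {F : H → ℝ}
    (hF : ContinuousOn F s) (h0 : ∀ x ∈ s, F x ≠ 0) :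
    (∀ x ∈ s, 0 < F x) ∨ (∀ x ∈ s, F x < 0) := by
  by_contra h
  push Not at h
  obtain ⟨⟨a, ha, hFa⟩, ⟨b, hb, hFb⟩⟩ := h
  obtain ⟨x, hx, hx0⟩ := hs.intermediate_value₂ ha hb hF continuousOn_const hFa hFb
  exact h0 x hx hx0

end SignConstancy

section Action

variable {G H : Type} [Group G] [TopologicalSpace H] [MulAction G H] [ContinuousConstSMul G H]

/-- The displacement `x ↦ u (γ • x) - u x` is continuous on the overlap `Ω ∩ γ⁻¹Ω`. [folklore] -/
theorem continuousOn_translate_sub {Ω : Set H} {u : H → ℝ} (hu : ContinuousOn u Ω) (γ : G) :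
    ContinuousOn (fun x ↦ u (γ • x) - u x) (Ω ∩ (fun x ↦ γ • x) ⁻¹' Ω) := by
  refine ContinuousOn.sub ?_ (hu.mono inter_subset_left)
  exact hu.comp (continuous_const_smul γ).continuousOn fun x hx ↦ hx.2

/-- The translate `x ↦ u (γ • x)` is continuous on the overlap `Ω ∩ γ⁻¹Ω`. [folklore] -/
theorem continuousOn_translate {Ω : Set H} {u : H → ℝ} (hu : ContinuousOn u Ω) (γ : G) :
    ContinuousOn (fun x ↦ u (γ • x)) (Ω ∩ (fun x ↦ γ • x) ⁻¹' Ω) :=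
  hu.comp (continuous_const_smul γ).continuousOn fun _ hx ↦ hx.2

/-- Sign dichotomy: if the displacement of `γ` is zero-free on the preconnected overlap
`Ω ∩ γ⁻¹Ω`, then `u < u ∘ γ` there or `u ∘ γ < u` there. [folklore] -/
theorem translate_gt_or_lt {Ω : Set H} {u : H → ℝ} (hu : ContinuousOn u Ω) {γ : G}
    (hconn : IsPreconnected (Ω ∩ (fun x ↦ γ • x) ⁻¹' Ω))
    (hne : ∀ x ∈ Ω, γ • x ∈ Ω → u (γ • x) ≠ u x) :
    (∀ x ∈ Ω, γ • x ∈ Ω → u x < u (γ • x)) ∨ (∀ x ∈ Ω, γ • x ∈ Ω → u (γ • x) < u x) := by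
  rcases pos_or_neg_of_forall_ne_zero hconn (continuousOn_translate_sub hu γ)
      (fun x hx ↦ sub_ne_zero.2 (hne x hx.1 hx.2)) with h | h
  · exact Or.inl fun x hx hγx ↦ sub_pos.1 (h x ⟨hx, hγx⟩)
  · exact Or.inr fun x hx hγx ↦ sub_neg.1 (h x ⟨hx, hγx⟩)

/-- **Zero-free displacements define a positive cone.** Let `G` act on `H` by homeomorphisms,
`u` be continuous on `Ω ⊆ H`, every overlap `Ω ∩ γ⁻¹Ω` be preconnected, and every pair `a b`
admit a point `x ∈ Ω` with `b • x ∈ Ω` and `a • b • x ∈ Ω`. If for every `γ ≠ 1` the translate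
`u ∘ (γ • ·)` never agrees with `u` on the overlap, then
`P := {γ ≠ 1 | u < u ∘ (γ • ·) on Ω ∩ γ⁻¹Ω}` is a positive cone of `G`. [folklore; the
point-set half of `TRIAGE-r2-2.md` §horizon-shadowed-bag (3)] -/
theorem positiveCone_of_translates_ne : ∀ {G H : Type} [Group G] [TopologicalSpace H] [MulAction G H] [ContinuousConstSMul G H] (Ω : Set H) (u : H → ℝ), ContinuousOn u Ω → (∀ γ : G, IsPreconnected (Ω ∩ (fun x ↦ γ • x) ⁻¹' Ω)) → (∀ a b : G, ∃ x ∈ Ω, b • x ∈ Ω ∧ a • b • x ∈ Ω) → (∀ γ : G, γ ≠ 1 → ∀ x ∈ Ω, γ • x ∈ Ω → u (γ • x) ≠ u x) → ∃ P : Set G, 1 ∉ P ∧ (∀ a ∈ P, ∀ b ∈ P, a * b ∈ P) ∧ ∀ γ : G, γ ≠ 1 → γ ∈ P ∨ γ⁻¹ ∈ P := by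
  intro G H _ _ _ _ Ω u hu hconn htriple hne
  refine ⟨{γ | γ ≠ 1 ∧ ∀ x ∈ Ω, γ • x ∈ Ω → u x < u (γ • x)}, fun h ↦ h.1 rfl, ?_, ?_⟩
  · rintro a ⟨_, ha⟩ b ⟨_, hb⟩
    obtain ⟨x, hx, hbx, habx⟩ := htriple a b
    have hlt : u x < u ((a * b) • x) := by
      rw [mul_smul]
      exact (hb x hx hbx).trans (ha (b • x) hbx habx)
    have hab : a * b ≠ 1 := by
      intro h
      rw [h, one_smul] at hlt
      exact lt_irrefl _ hlt
    refine ⟨hab, ?_⟩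
    rcases translate_gt_or_lt hu (hconn (a * b)) (hne (a * b) hab) with h | h
    · exact h
    · have habx' : (a * b) • x ∈ Ω := by rwa [mul_smul]
      exact absurd hlt (lt_asymm (h x hx habx'))
  · intro γ hγ
    rcases translate_gt_or_lt hu (hconn γ) (hne γ hγ) with h | h
    · exact Or.inl ⟨hγ, h⟩
    · refine Or.inr ⟨inv_ne_one.2 hγ, fun y hy hγy ↦ ?_⟩
      have := h (γ⁻¹ • y) hγy (by rwa [smul_inv_smul])
      rwa [smul_inv_smul] at this

/-- **A positive cone is a left-invariant strict total order** (`a < b :↔ a⁻¹ * b ∈ P`), i.e. a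
group with a positive cone is left-orderable. [cite: CalegariRolfsen2014, §2] -/
theorem leftInvariantOrder_of_positiveCone : ∀ {G : Type} [Group G] (P : Set G), 1 ∉ P → (∀ a ∈ P, ∀ b ∈ P, a * b ∈ P) → (∀ γ : G, γ ≠ 1 → γ ∈ P ∨ γ⁻¹ ∈ P) → ∃ lt : G → G → Prop, (∀ a, ¬ lt a a) ∧ (∀ a b c, lt a b → lt b c → lt a c) ∧ (∀ a b, a ≠ b → lt a b ∨ lt b a) ∧ ∀ a b c, lt a b → lt (c * a) (c * b) := by
  intro G _ P h1 hmul htot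
  refine ⟨fun a b ↦ a⁻¹ * b ∈ P, ?_, ?_, ?_, ?_⟩
  · intro a (h : a⁻¹ * a ∈ P)
    rw [inv_mul_cancel] at h
    exact h1 h
  · intro a b c (hab : a⁻¹ * b ∈ P) (hbc : b⁻¹ * c ∈ P)
    show a⁻¹ * c ∈ P
    have := hmul _ hab _ hbc
    rwa [mul_assoc, mul_inv_cancel_left] at this
  · intro a b hab
    show a⁻¹ * b ∈ P ∨ b⁻¹ * a ∈ P
    rcases htot (a⁻¹ * b) (fun h ↦ hab (inv_mul_eq_one.1 h)) with h | h
    · exact Or.inl h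
    · right
      rwa [mul_inv_rev, inv_inv] at h
  · intro a b c (hab : a⁻¹ * b ∈ P)
    show (c * a)⁻¹ * (c * b) ∈ P
    rwa [mul_inv_rev, mul_assoc, inv_mul_cancel_left]

/-- **Non-left-orderable groups force coincidences** (entire version). If `G` carries no
left-invariant strict total order and acts by homeomorphisms on a nonempty preconnected space `H`,
then every continuous `u : H → ℝ` agrees with one of its non-trivial translates somewhere: some
`γ ≠ 1` and `x` have `u (γ • x) = u x`. (Triage's use: `H = H³`, `G = π₁ Y` for a closed
hyperbolic `Y` with non-left-orderable fundamental group, `u = log T` along an entire achronal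
lift of a bag-sided slab — the slab is not injectively projected.) [folklore] -/
theorem exists_translate_eq_of_not_leftOrderable : ∀ {G H : Type} [Group G] [TopologicalSpace H] [PreconnectedSpace H] [Nonempty H] [MulAction G H] [ContinuousConstSMul G H], (¬ ∃ lt : G → G → Prop, (∀ a, ¬ lt a a) ∧ (∀ a b c, lt a b → lt b c → lt a c) ∧ (∀ a b, a ≠ b → lt a b ∨ lt b a) ∧ ∀ a b c, lt a b → lt (c * a) (c * b)) → ∀ u : H → ℝ, Continuous u → ∃ γ : G, γ ≠ 1 ∧ ∃ x : H, u (γ • x) = u x := by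
  intro G H _ _ _ _ _ _ hG u hu
  by_contra h
  push Not at h
  have hconn : ∀ γ : G, IsPreconnected ((univ : Set H) ∩ (fun x ↦ γ • x) ⁻¹' univ) := fun γ ↦ by
    simpa using isPreconnected_univ
  have htriple : ∀ a b : G, ∃ x ∈ (univ : Set H), b • x ∈ (univ : Set H) ∧ a • b • x ∈ (univ : Set H) :=
    fun a b ↦ ⟨Classical.arbitrary H, mem_univ _, mem_univ _, mem_univ _⟩
  have hne : ∀ γ : G, γ ≠ 1 → ∀ x ∈ (univ : Set H), γ • x ∈ (univ : Set H) → u (γ • x) ≠ u x :=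
    fun γ hγ x _ _ ↦ h γ hγ x
  obtain ⟨P, h1, hmul, htot⟩ :=
    positiveCone_of_translates_ne (univ : Set H) u hu.continuousOn hconn htriple hne
  exact hG (leftInvariantOrder_of_positiveCone P h1 hmul htot)

/-- **Non-left-orderable groups force coincidences** (domain version): under the overlap
hypotheses of `positiveCone_of_translates_ne`, if `G` is not left-orderable then some `γ ≠ 1`
has a coincidence point on `Ω ∩ γ⁻¹Ω`. [folklore] -/
theorem exists_translate_eq_on_of_not_leftOrderable {Ω : Set H} {u : H → ℝ}
    (hG : ¬ ∃ lt : G → G → Prop, (∀ a, ¬ lt a a) ∧ (∀ a b c, lt a b → lt b c → lt a c) ∧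
      (∀ a b, a ≠ b → lt a b ∨ lt b a) ∧ ∀ a b c, lt a b → lt (c * a) (c * b))
    (hu : ContinuousOn u Ω) (hconn : ∀ γ : G, IsPreconnected (Ω ∩ (fun x ↦ γ • x) ⁻¹' Ω))
    (htriple : ∀ a b : G, ∃ x ∈ Ω, b • x ∈ Ω ∧ a • b • x ∈ Ω) :
    ∃ γ : G, γ ≠ 1 ∧ ∃ x ∈ Ω, γ • x ∈ Ω ∧ u (γ • x) = u x := by
  by_contra h
  push Not at h
  obtain ⟨P, h1, hmul, htot⟩ := positiveCone_of_translates_ne Ω u hu hconn htriple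
    (fun γ hγ x hx hγx ↦ h γ hγ x hx hγx)
  exact hG (leftInvariantOrder_of_positiveCone P h1 hmul htot)

/-- **An attained maximum forces a coincidence, for every deck transformation.** If `u` is
continuous on `Ω`, attains its maximum over `Ω` at `m`, and `γ • m`, `γ⁻¹ • m` stay in `Ω`
(with `Ω ∩ γ⁻¹Ω` preconnected), then `u (γ • x) = u x` for some `x` in the overlap: the
displacement is `≤ 0` at `m` and `≥ 0` at `γ⁻¹ • m`. No hypothesis on the group is needed, so an
achronal lifted slab whose height attains an extremum meets EACH of its deck translates.
[folklore] -/
theorem exists_translate_eq_of_isMaxOn : ∀ {G H : Type} [Group G] [TopologicalSpace H] [MulAction G H] [ContinuousConstSMul G H] (Ω : Set H) (u : H → ℝ), ContinuousOn u Ω → ∀ (γ : G) (m : H), IsPreconnected (Ω ∩ (fun x ↦ γ • x) ⁻¹' Ω) → IsMaxOn u Ω m → m ∈ Ω → γ • m ∈ Ω → γ⁻¹ • m ∈ Ω → ∃ x ∈ Ω, γ • x ∈ Ω ∧ u (γ • x) = u x := by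
  intro G H _ _ _ _ Ω u hu γ m hconn hmax hm hγm hγ'm
  have ha : m ∈ Ω ∩ (fun x ↦ γ • x) ⁻¹' Ω := ⟨hm, hγm⟩
  have hb : γ⁻¹ • m ∈ Ω ∩ (fun x ↦ γ • x) ⁻¹' Ω := ⟨hγ'm, by simpa [smul_inv_smul] using hm⟩
  obtain ⟨x, hx, hux⟩ := hconn.intermediate_value₂ ha hb (continuousOn_translate hu γ)
    (hu.mono inter_subset_left) (hmax hγm) (by simpa [smul_inv_smul] using hmax hγ'm)
  exact ⟨x, hx.1, hx.2, hux⟩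

/-- **An attained minimum forces a coincidence, for every deck transformation** (the mirror
image of `exists_translate_eq_of_isMaxOn`). [folklore] -/
theorem exists_translate_eq_of_isMinOn {Ω : Set H} {u : H → ℝ} (hu : ContinuousOn u Ω)
    (γ : G) {m : H} (hconn : IsPreconnected (Ω ∩ (fun x ↦ γ • x) ⁻¹' Ω)) (hmin : IsMinOn u Ω m)
    (hm : m ∈ Ω) (hγm : γ • m ∈ Ω) (hγ'm : γ⁻¹ • m ∈ Ω) :
    ∃ x ∈ Ω, γ • x ∈ Ω ∧ u (γ • x) = u x := by
  obtain ⟨x, hx, hγx, hux⟩ := exists_translate_eq_of_isMaxOn Ω (fun x ↦ -u x) hu.neg γ m hconn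
    hmin.neg hm hγm hγ'm
  exact ⟨x, hx, hγx, neg_injective hux⟩

/-- Entire version of `exists_translate_eq_of_isMaxOn`: on a preconnected space, a continuous
function with an attained maximum agrees somewhere with each of its translates. [folklore] -/
theorem exists_translate_eq_of_forall_le [PreconnectedSpace H] {u : H → ℝ} (hu : Continuous u)
    {m : H} (hmax : ∀ y, u y ≤ u m) (γ : G) : ∃ x : H, u (γ • x) = u x := by
  have hconn : IsPreconnected ((univ : Set H) ∩ (fun x ↦ γ • x) ⁻¹' univ) := by
    simpa using isPreconnected_univ
  obtain ⟨x, -, -, hux⟩ := exists_translate_eq_of_isMaxOn (univ : Set H) u hu.continuousOn γ m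
    hconn (isMaxOn_iff.2 fun y _ ↦ hmax y) (mem_univ _) (mem_univ _) (mem_univ _)
  exact ⟨x, hux⟩

end Action

section Shift

/-- **The 1+1 toy core: an attained minimum forces a coincidence with every shift.** If
`h : ℝ → ℝ` is continuous and attains its minimum, then for every `ℓ` some `x` has
`h (x + ℓ) = h x` (intermediate value theorem for `x ↦ h (x + ℓ) - h x`, which is `≥ 0` at the
minimiser `m` and `≤ 0` at `m - ℓ`). [folklore; `Ideas/horizon-shadowed-bag.md`, Cheapest
falsifier (2)] -/
theorem exists_shift_eq_of_forall_le {h : ℝ → ℝ} (hh : Continuous h) {m : ℝ} (hm : ∀ y, h m ≤ h y)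
    (ℓ : ℝ) : ∃ x : ℝ, h (x + ℓ) = h x :=
  intermediate_value_univ₂ (a := m - ℓ) (b := m) (f := fun x ↦ h (x + ℓ)) (g := h)
    (hh.comp (continuous_id.add continuous_const)) hh (by simpa using hm (m - ℓ)) (hm (m + ℓ))

/-- **The 1+1 toy core, coercive form.** A continuous `h : ℝ → ℝ` tending to `+∞` at both ends
(the height `ln T` of an inextendible spacelike slice with both ends at `T = ∞`) agrees with each
of its shifts somewhere; in the strip `χ ∼ χ + ℓ` the slice therefore self-intersects.
[folklore; `Ideas/horizon-shadowed-bag.md`, Cheapest falsifier (2), gap "min attained" closed by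
the extreme value theorem] -/
theorem exists_shift_eq_of_tendsto_atTop : ∀ (h : ℝ → ℝ) (ℓ : ℝ), Continuous h → Filter.Tendsto h Filter.atBot Filter.atTop → Filter.Tendsto h Filter.atTop Filter.atTop → ∃ x : ℝ, h (x + ℓ) = h x := by
  intro h ℓ hh hbot htop
  have hlim : Tendsto h (cocompact ℝ) atTop := by
    rw [cocompact_eq_atBot_atTop]
    exact hbot.sup htop
  obtain ⟨m, hm⟩ := hh.exists_forall_le hlim
  exact exists_shift_eq_of_forall_le hh hm ℓ

end Shift

end Summit.FinalStateConjecture.FinalStateConjecture.Theorems.LaminatedThreshold.HorizonShadowedBag
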